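import Summits.Ventures.AbcSig.Rows.XTemplateC2a
import Summits.Ventures.AbcSig.Levels.N12256
import Summits.Ventures.AbcSig.Levels.N766

/-!
# Venture AbcSig — ROW `C2aL383A3`: `xⁿ + 2^3·383^m·yⁿ = z²`, class `a = 3`, over the level files 12256 (norm-form certificates) and 766 (norm-form certificates) (GENERATED by p-lean g4 `gen4/c2arow2.py`)

HONEST FRAMING. A row of a COMPUTATION cell (`pub-abcsig`); a CONDITIONAL theorem, no claim on ABC or any summit.
Hypotheses: `BS04Package` (CITED: [BS04] Lemma 3.3 + (3.1) + Lemma 4.2); `DataComplete` at both levels and `RefinesCPSymAll` at the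
norm-form level(s) (COMPUTED: certified engine-1 level files; `Sieve/CharpolyCert.lean` / `Sieve/CharpolyTwist.lean`);
and the listed per-orbit exclusions `hX_…` (CITED: the row of record's module closures — M4 Kraus / M6 / M8 / [BS04, Prop 4.4/4.6] as its R3
names them; nothing of those is checked here). Exponent range: prime `n ≥ 11`, `n ≠ 383`; `B = 2^3·383^m`, `1 ≤ m < n`
(RULING H1 reduced exponents).
Residual of record: none. CITED per the row of record's R3 at 12256: 12256.9 @ 11: M4; 12256.10 @ 11: M4. Level 766 (norm form): no residue ≥ 11.
Row of record: `census/rows/C2a/C2a-l383-a3.md` (sha16 `96753c26a93fb35d`; SIGNED 2026-08-22T17:51:55Z by referee (ref-g14)).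
-/

namespace Summit.Ventures.AbcSig

/-- Row `C2aL383A3`: class `a = 3`, first distribution, prime `n ≥ 11`, `n ≠ 383`; conditional on the named hypotheses. -/
theorem xrow_C2aL383A3 (M : NewformModel) (hP : M.BS04Package)
    (hD12256 : M.DataComplete 12256 level12256Orbits) (hCP12256 : M.RefinesCPSymAll 12256 level12256CP)
    (hD766 : M.DataComplete 766 level766Orbits) (hCP766 : M.RefinesCPSymAll 766 level766CP)
    (n : ℕ) (hn : n.Prime) (hmin : 11 ≤ n) (hnℓ : n ≠ 383) (m : ℕ) (hm : 1 ≤ m) (hmn : m < n)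
    (hX_orbit_12256_9 : n ∈ ([11] : List ℕ) → M.Excludes 12256 orbit_12256_9
      (famB (2 ^ 3 * 383 ^ m) n (fun _ _ => True)))
    (hX_orbit_12256_10 : n ∈ ([11] : List ℕ) → M.Excludes 12256 orbit_12256_10
      (famB (2 ^ 3 * 383 ^ m) n (fun _ _ => True)))
    (x y z : ℤ) (hxy1 : x * y ≠ 1) (hxy2 : x * y ≠ -1) : ¬ IsPrimitiveSolution 1 (2 ^ 3 * 383 ^ m) 1 n x y z := by
  have hℓ : Nat.Prime 383 := by norm_num
  have h7 : 7 ≤ n := by omega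
  exact xrowC2a_a3 383 hℓ (by norm_num) M hP n hn h7 hnℓ hD12256 hD766 m hm hmn
    (level12256_sieve M hP hCP12256 n hn h7 (fun o => M.Excludes 12256 o
      (famB (2 ^ 3 * 383 ^ m) n (fun _ _ => True)) ∨ M.ExcludesStd 12256 o n) (fun _ h => Or.inr h) (fun hmem => by
      obtain rfl : n = 7 := by simpa using hmem
      omega) (fun hmem => by
      obtain rfl : n = 7 := by simpa using hmem
      omega) (fun hmem => by
      obtain rfl : n = 7 := by simpa using hmem
      omega) (fun hmem => by
      obtain rfl : n = 7 := by simpa using hmem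
      omega) (fun hmem => by
      obtain rfl : n = 11 := by simpa using hmem
      exact Or.inl (hX_orbit_12256_9 (by simp))) (fun hmem => by
      obtain rfl : n = 11 := by simpa using hmem
      exact Or.inl (hX_orbit_12256_10 (by simp))))
    (level766_sieve M hP hCP766 n hn h7 (fun o => M.Excludes 766 o
      (famB (2 ^ 3 * 383 ^ m) n (fun _ _ => True)) ∨ M.ExcludesStd 766 o n) (fun _ h => Or.inr h) (fun hmem => by
      obtain rfl : n = 7 := by simpa using hmem
      omega) (fun hmem => by
      obtain rfl : n = 7 := by simpa using hmem
      omega))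
    x y z hxy1 hxy2

end Summit.Ventures.AbcSig
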